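import Summits.Schanuel.Schanuel.Theorems.DiophantineDichotomyApproximationPropertyZeroDimDictionary
import Literature.RingTheory.MvPolynomial.HomogeneousHilbertFunction
import Literature.RingTheory.MvPolynomial.HomogeneousDimension
import Mathlib.LinearAlgebra.FiniteDimensional.Lemmas
import Mathlib.Analysis.SpecialFunctions.Pow.Real
import HarnessLib

/-!
# Stub plan `CycleAPIAt3`, Tier 0 (trunk): clause monotonicity and the two real-arithmetic lemmas

Crux `stmt-Schanuel-6117` (`Summit.Schanuel.Schanuel.Theses.DiophantineDichotomy.ApproximationProperty`),
line `orbit-interpolation-determinant`, registered stub `CycleAPIAt3 : CycleAPIAt 3`; stub plan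
`Cruxes/ApproximationProperty/STUB-PLAN-CycleAPIAt3.md` (critic
`planner-scrit-stmt-Schanuel-6117-CycleAPIAt3-0`), typed helpers `STUB_PLAN_CycleAPIAt3.lean`.
This file proves the three Tier-0 helpers of the plan, each a registered sub-goal of the crux item:

* `clause_mono_level` (P0a) — the interpolation clause `dim ℚ[x̲]_δ = dim 𝔭_δ + deg 𝔭` of a
  homogeneous prime `𝔭 ⊂ ℚ[x₀, …, x_m]` of rank `1` is MONOTONE in the level: it propagates from `δ`
  to every `δ' ≥ δ`. The Hilbert function `H(𝔭; ·)` is non-decreasing (a variable outside `𝔭`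
  is a linear non-zero-divisor: `Literature.RingTheory.MvPolynomial.hilbert_sup_span_add_hilbert_eq`,
  as in the landed `HilbertTruncation.hilbert_mono_of_ringKrullDim_ne_zero`) and bounded by `deg 𝔭`
  (rank–nullity for the evaluation at a normalised zero, as in the landed
  `finrank_homogeneousSubmodule_le`), so `deg 𝔭 = H(𝔭; δ) ≤ H(𝔭; δ') ≤ deg 𝔭`. This is what
  makes `CycleAPIAt t` monotone in its constant `c` (the "two-constant trick" of the plan). The two
  landed lemmas live in `…ClauseFree.lean` / `…HilbertTruncation.lean`, whose compiled modules were
  not yet available on the farm when this file was written; their short proofs are re-run here as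
  `private` lemmas (no public duplicate).
* `floor_arith` (P2-ℝ) — pure real bookkeeping: the orbit-floor inequality
  `D(Δh̄ + Y)/c_d ≤ C(δL + Dh̄ + D log(D+2) + √(D(Dh̄+D)L))` forces
  `L ≥ Δ(Δh̄ + Y)/(16 C² c_d²)` in the regime `Δ ≥ 8Cc_d`, `Y ≥ max(Δ, 8Cc_d log(D+2))`,
  `Δδ ≤ 4Cc_d D`.
* `restart_threshold_arith` (P4-ℝ) — pure real bookkeeping: that floor beats the restart
  threshold `C(Δ/c_f + 1)(Δ h(𝔮) + Y δ)` of a container of degree `δ` and height `≤ p(h̄+1)` once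
  `c_f ≥ 16 C C₁ c_d² (p+1) δ` and `Δ ≥ c_f`.

Proofs only (no definitions, no named facts). Sources: NesterenkoPhilippon2001 (LNM 1752) Ch. 3 §4–5;
Philippon1986 Lemme 3.1 (monotonicity of the Hilbert function); folklore real analysis.
-/

noncomputable section

-- `Summit.Schanuel.Schanuel.…` is the mandated summit/sub-problem namespace (single-conjunct summit), hence:
set_option linter.dupNamespace false

attribute [local instance] MvPolynomial.gradedAlgebra

namespace Summit.Schanuel.Schanuel.Cruxes.ApproximationProperty.OrbitInterpolationDeterminant

open Literature.NumberTheory.Transcendental.Nesterenko MvPolynomial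
open scoped BigOperators

namespace CycleAPIAt3Trunk

variable {m : ℕ} {𝔭 : Ideal (Rx m)}

-- adapted from `finrank_homogeneousSubmodule_le` (…ClauseFree.lean, module not yet built on the farm)
/-- `dim ℚ[x̲]_δ ≤ dim 𝔭_δ + deg 𝔭` for every `δ`, given a normalised zero `b̄'` (`b'_j = 1`):
the evaluation map `ℚ[x̲]_δ → K = ℚ(b̄')` has kernel `𝔭_δ` and target of dimension `deg 𝔭`.
[cite: NesterenkoPhilippon2001, Ch. 3 §5 (p. 42)] -/
private theorem finrank_le_of_normalisedZero (h𝔭 : 𝔭.IsPrime)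
    (hhom : 𝔭.IsHomogeneous (homogeneousSubmodule (Fin (m + 1)) ℚ)) (hunm : IsUnmixedOfRank 𝔭 1)
    {b' : Fin (m + 1) → ℂ} (hb' : b' ∈ projZeros 𝔭) {j : Fin (m + 1)} (hj : b' j = 1)
    [NumberField ↥(IntermediateField.adjoin ℚ (Set.range b'))]
    {b : Fin (m + 1) → ↥(IntermediateField.adjoin ℚ (Set.range b'))} (hb : ∀ k, (b k : ℂ) = b' k)
    (δ : ℕ) :
    Module.finrank ℚ ↥(homogeneousSubmodule (Fin (m + 1)) ℚ δ) ≤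
      Module.finrank ℚ ↥(homogeneousSubmodule (Fin (m + 1)) ℚ δ ⊓ 𝔭.restrictScalars ℚ) +
        ideg 𝔭 1 := by
  classical
  set W : Submodule ℚ (Rx m) := homogeneousSubmodule (Fin (m + 1)) ℚ δ with hW
  haveI : FiniteDimensional ℚ ↥W := Module.Finite.iff_fg.mpr (homogeneousSubmodule_fg _ _ δ)
  set ev : ↥W →ₗ[ℚ] ↥(IntermediateField.adjoin ℚ (Set.range b')) :=
    (aeval b).toLinearMap.comp W.subtype with hev
  have hkerW : LinearMap.ker ev = Submodule.comap W.subtype (W ⊓ 𝔭.restrictScalars ℚ) := by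
    ext ⟨G, hG⟩
    have hG' : G.IsHomogeneous δ := (mem_homogeneousSubmodule δ G).mp hG
    simp only [LinearMap.mem_ker, hev, LinearMap.comp_apply, Submodule.subtype_apply,
      AlgHom.toLinearMap_apply, Submodule.mem_comap, Submodule.mem_inf, hG, true_and,
      Submodule.restrictScalars_mem]
    exact (mem_iff_aeval_eq_zero h𝔭 hhom hunm hb' hj hb hG').symm
  have hfr : Module.finrank ℚ ↥(LinearMap.ker ev) =
      Module.finrank ℚ ↥(W ⊓ 𝔭.restrictScalars ℚ) := by
    rw [hkerW]
    exact LinearEquiv.finrank_eq (Submodule.comapSubtypeEquivOfLe inf_le_left)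
  have hrn := LinearMap.finrank_range_add_finrank_ker ev
  have hrange : Module.finrank ℚ ↥(LinearMap.range ev) ≤ ideg 𝔭 1 := by
    rw [← finrank_eq_ideg h𝔭 hhom hunm hb' hj hb]
    exact Submodule.finrank_le _
  calc Module.finrank ℚ ↥W
      = Module.finrank ℚ ↥(LinearMap.range ev) + Module.finrank ℚ ↥(LinearMap.ker ev) := hrn.symm
    _ = Module.finrank ℚ ↥(LinearMap.range ev) +
          Module.finrank ℚ ↥(W ⊓ 𝔭.restrictScalars ℚ) := by rw [hfr]
    _ ≤ ideg 𝔭 1 + Module.finrank ℚ ↥(W ⊓ 𝔭.restrictScalars ℚ) := Nat.add_le_add_right hrange _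
    _ = Module.finrank ℚ ↥(W ⊓ 𝔭.restrictScalars ℚ) + ideg 𝔭 1 := add_comm _ _

/-- `dim ℚ[x̲]_δ ≤ dim 𝔭_δ + deg 𝔭` for EVERY `δ` (the evaluation map at a normalised zero has
kernel `𝔭_δ` and target of dimension `deg 𝔭`); the normalised zero is produced here, so the
statement carries no auxiliary data. [cite: NesterenkoPhilippon2001, Ch. 3 §5 (p. 42)] -/
theorem finrank_le_finrank_inf_add_ideg (h𝔭 : 𝔭.IsPrime)
    (hhom : 𝔭.IsHomogeneous (homogeneousSubmodule (Fin (m + 1)) ℚ)) (hunm : IsUnmixedOfRank 𝔭 1)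
    (δ : ℕ) :
    Module.finrank ℚ ↥(homogeneousSubmodule (Fin (m + 1)) ℚ δ) ≤
      Module.finrank ℚ ↥(homogeneousSubmodule (Fin (m + 1)) ℚ δ ⊓ 𝔭.restrictScalars ℚ) +
        ideg 𝔭 1 := by
  obtain ⟨β₀, hβ₀⟩ := projZeros_nonempty' h𝔭 hhom hunm
  obtain ⟨j, hj0⟩ := Function.ne_iff.mp hβ₀.1
  have hb' : (β₀ j)⁻¹ • β₀ ∈ projZeros 𝔭 :=
    Literature.NumberTheory.Transcendental.PhilipponMain.smul_mem_projZeros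
      (fun P hP k => homogeneousComponent_mem_of_mem hhom hP k) hβ₀ (inv_ne_zero hj0)
  have hj : ((β₀ j)⁻¹ • β₀) j = 1 := by
    rw [Pi.smul_apply, smul_eq_mul, inv_mul_cancel₀ hj0]
  haveI := numberField_adjoin h𝔭 hhom hunm hb' hj
  let b : Fin (m + 1) → ↥(IntermediateField.adjoin ℚ (Set.range ((β₀ j)⁻¹ • β₀))) := fun k =>
    ⟨((β₀ j)⁻¹ • β₀) k, IntermediateField.subset_adjoin ℚ _ ⟨k, rfl⟩⟩
  have hb : ∀ k, (b k : ℂ) = ((β₀ j)⁻¹ • β₀) k := fun k => rfl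
  exact finrank_le_of_normalisedZero h𝔭 hhom hunm hb' hj hb δ

-- adapted from `HilbertTruncation.hilbert_mono_of_ringKrullDim_ne_zero` (module not yet built on the farm)
/-- The Hilbert function of a homogeneous prime of rank `1` is non-decreasing, in the
`S_δ ⊓ 𝔭`-form used by the clause (a variable outside `𝔭` — one exists since `dim ℚ[x̲]/𝔭 = 1 ≠ 0`
— is a linear non-zero-divisor, and `H(𝔭 + (x_i); t+1) + H(𝔭; t) = H(𝔭; t+1)`).
[cite: Philippon1986, Lemme 3.1] -/
theorem hilbert_mono_rankOne (h𝔭 : 𝔭.IsPrime)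
    (hhom : 𝔭.IsHomogeneous (homogeneousSubmodule (Fin (m + 1)) ℚ)) (hunm : IsUnmixedOfRank 𝔭 1)
    {δ δ' : ℕ} (hδ : δ ≤ δ') :
    Module.finrank ℚ ↥(homogeneousSubmodule (Fin (m + 1)) ℚ δ) -
        Module.finrank ℚ ↥(homogeneousSubmodule (Fin (m + 1)) ℚ δ ⊓ 𝔭.restrictScalars ℚ) ≤
      Module.finrank ℚ ↥(homogeneousSubmodule (Fin (m + 1)) ℚ δ') -
        Module.finrank ℚ ↥(homogeneousSubmodule (Fin (m + 1)) ℚ δ' ⊓ 𝔭.restrictScalars ℚ) := by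
  haveI := h𝔭
  have hdim : ringKrullDim (Rx m ⧸ 𝔭) ≠ 0 := by
    rw [rank_eq_one h𝔭 hunm]; exact_mod_cast Nat.one_ne_zero
  obtain ⟨i, hi⟩ := Literature.RingTheory.MvPolynomial.exists_X_notMem_of_ringKrullDim_ne_zero hdim
  have hnzd : ∀ f, (X i : Rx m) * f ∈ 𝔭 → f ∈ 𝔭 := fun f hf =>
    (h𝔭.mem_or_mem hf).resolve_left hi
  have e : ∀ d : ℕ, Literature.RingTheory.MvPolynomial.idealDegree 𝔭 d =
      homogeneousSubmodule (Fin (m + 1)) ℚ d ⊓ 𝔭.restrictScalars ℚ := fun d => inf_comm _ _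
  -- one step, then induction on `δ ≤ δ'`
  have hstep : ∀ t : ℕ,
      Module.finrank ℚ ↥(homogeneousSubmodule (Fin (m + 1)) ℚ t) -
          Module.finrank ℚ ↥(homogeneousSubmodule (Fin (m + 1)) ℚ t ⊓ 𝔭.restrictScalars ℚ) ≤
        Module.finrank ℚ ↥(homogeneousSubmodule (Fin (m + 1)) ℚ (t + 1)) -
          Module.finrank ℚ ↥(homogeneousSubmodule (Fin (m + 1)) ℚ (t + 1) ⊓
            𝔭.restrictScalars ℚ) := by
    intro t
    have h := Literature.RingTheory.MvPolynomial.hilbert_sup_span_add_hilbert_eq hhom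
      (X_ne_zero i) (isHomogeneous_X ℚ i) hnzd t
    rw [e, e] at h
    omega
  induction hδ with
  | refl => exact le_rfl
  | step _ ih => exact ih.trans (hstep _)

end CycleAPIAt3Trunk

/-- **Registered sub-goal `clause_mono_level`** (stub plan `CycleAPIAt3`, P0a): the interpolation
clause of a homogeneous prime `𝔭 ⊂ ℚ[x₀, …, x_m]` of rank `1` is monotone in the level — if the
zeros of `𝔭` impose independent conditions on the forms of degree `δ`
(`dim ℚ[x̲]_δ = dim 𝔭_δ + deg 𝔭`) then they do so in every degree `δ' ≥ δ`
(`deg 𝔭 = H(𝔭; δ) ≤ H(𝔭; δ') ≤ deg 𝔭`). [cite: NesterenkoPhilippon2001, Ch. 3 §5 (p. 42); Philippon1986, Lemme 3.1] -/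
theorem clause_mono_level : ∀ (m : ℕ) (𝔭 : Ideal (Rx m)), 𝔭.IsPrime →
    𝔭.IsHomogeneous (homogeneousSubmodule (Fin (m + 1)) ℚ) → IsUnmixedOfRank 𝔭 1 →
    ∀ (δ δ' : ℕ), δ ≤ δ' →
    Module.finrank ℚ ↥(homogeneousSubmodule (Fin (m + 1)) ℚ δ) =
      Module.finrank ℚ ↥(homogeneousSubmodule (Fin (m + 1)) ℚ δ ⊓ 𝔭.restrictScalars ℚ) +
        ideg 𝔭 1 →
    Module.finrank ℚ ↥(homogeneousSubmodule (Fin (m + 1)) ℚ δ') =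
      Module.finrank ℚ ↥(homogeneousSubmodule (Fin (m + 1)) ℚ δ' ⊓ 𝔭.restrictScalars ℚ) +
        ideg 𝔭 1 := by
  intro m 𝔭 h𝔭 hhom hunm δ δ' hδ hclause
  have hle := CycleAPIAt3Trunk.finrank_le_finrank_inf_add_ideg h𝔭 hhom hunm δ'
  have hmono := CycleAPIAt3Trunk.hilbert_mono_rankOne h𝔭 hhom hunm hδ
  have hinf := Literature.RingTheory.MvPolynomial.finrank_idealDegree_le 𝔭 δ'
  rw [show Literature.RingTheory.MvPolynomial.idealDegree 𝔭 δ' =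
      homogeneousSubmodule (Fin (m + 1)) ℚ δ' ⊓ 𝔭.restrictScalars ℚ from inf_comm _ _] at hinf
  omega

/-- **Registered sub-goal `floor_arith`** (stub plan `CycleAPIAt3`, P2-ℝ; pure real bookkeeping,
numerically sampled by the critic): from the orbit-floor inequality together with the smallness
`S ≥ D(Δh̄ + Y)/c_d` one extracts `L ≥ Δ(Δh̄ + Y)/(16 C² c_d²)` once `Δ ≥ 8 C c_d`,
`Y ≥ max(Δ, 8 C c_d log(D+2))`, `D ≥ Δδ/(4 C c_d)`. [folklore] -/
theorem floor_arith : ∀ (C cd Δ Y D hbar L δ : ℝ), 1 ≤ C → 1 ≤ cd → 8 * C * cd ≤ Δ →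
    Δ ≤ Y → 8 * C * cd * Real.log (D + 2) ≤ Y → 1 ≤ D → 0 ≤ hbar → 1 ≤ δ →
    Δ * δ ≤ 4 * C * cd * D → 1 ≤ L →
    D * (Δ * hbar + Y) / cd ≤
      C * (δ * L + D * hbar + D * Real.log (D + 2) + Real.sqrt (D * (D * hbar + D) * L)) →
    Δ * (Δ * hbar + Y) / (16 * C ^ 2 * cd ^ 2) ≤ L := by
  intro C cd Δ Y D hbar L δ hC hcd hΔ hY hlog hD hh hδ hDδ hL hfloor
  have hcd0 : 0 < cd := by linarith
  have hC0 : 0 < C := by linarith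
  have hD0 : 0 < D := by linarith
  have hδ0 : 0 < δ := by linarith
  have hΔ0 : 0 < Δ := by nlinarith
  have hY0 : 0 ≤ Y := by linarith
  have hh1 : 0 < hbar + 1 := by linarith
  set A : ℝ := Δ * hbar + Y with hA
  have hAΔ : Δ * (hbar + 1) ≤ A := by rw [hA]; nlinarith
  have hA0 : 0 < A := lt_of_lt_of_le (by positivity) hAΔ
  set S : ℝ := D * A / cd with hS
  have hScd : S * cd = D * A := by rw [hS]; field_simp
  -- the two small terms are absorbed: `8 C D h̄ ≤ S`, `8 C D log(D+2) ≤ S`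
  have h1 : 8 * (C * (D * hbar)) ≤ S := by
    rw [hS, le_div_iff₀ hcd0]
    have e1 : 8 * C * cd * (D * hbar) ≤ Δ * (D * hbar) :=
      mul_le_mul_of_nonneg_right hΔ (by positivity)
    have e2 : Δ * (D * hbar) ≤ D * A := by rw [hA]; nlinarith [mul_nonneg hD0.le hY0]
    linarith
  have h2 : 8 * (C * (D * Real.log (D + 2))) ≤ S := by
    rw [hS, le_div_iff₀ hcd0]
    have e1 : D * (8 * C * cd * Real.log (D + 2)) ≤ D * Y := mul_le_mul_of_nonneg_left hlog hD0.le
    have e2 : D * Y ≤ D * A := by rw [hA]; nlinarith [mul_nonneg hD0.le (mul_nonneg hΔ0.le hh)]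
    linarith
  -- hence `3S/4 ≤ C δ L + C √(…)`
  have hmain : 3 * S / 4 ≤ C * (δ * L) + C * Real.sqrt (D * (D * hbar + D) * L) := by
    linarith
  by_cases hcase : 3 * S / 8 ≤ C * (δ * L)
  · -- the spread branch: `L ≥ 3S/(8Cδ)` and `D/δ ≥ Δ/(4 C cd)`
    have e1 : 3 * (D * A) ≤ 8 * C * δ * L * cd := by
      have h' : 3 * S ≤ 8 * (C * (δ * L)) := by linarith
      have h'' := mul_le_mul_of_nonneg_right h' hcd0.le
      rw [show 3 * S * cd = 3 * (D * A) by rw [mul_assoc, hScd]] at h''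
      linarith
    have e2 : Δ * δ * A ≤ 4 * C * cd * D * A := mul_le_mul_of_nonneg_right hDδ hA0.le
    have e3 : 3 * (Δ * δ * A) ≤ 4 * C * cd * (8 * C * δ * L * cd) := by
      have h' := mul_le_mul_of_nonneg_left e1 (by positivity : (0:ℝ) ≤ 4 * C * cd)
      linarith
    have e4 : 3 * (Δ * A) ≤ 32 * C ^ 2 * cd ^ 2 * L := by
      have h' : (3 * (Δ * A)) * δ ≤ (32 * C ^ 2 * cd ^ 2 * L) * δ := by linarith [e3]
      exact le_of_mul_le_mul_right h' hδ0
    rw [div_le_iff₀ (by positivity)]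
    linarith [e4, (by positivity : (0:ℝ) ≤ C ^ 2 * cd ^ 2 * L)]
  · -- the cluster branch: `3S/8 ≤ C √(D (D h̄ + D) L)`
    push Not at hcase
    have hsq : 3 * S / 8 ≤ C * Real.sqrt (D * (D * hbar + D) * L) := by linarith
    have hin : 0 ≤ D * (D * hbar + D) * L := by positivity
    have hsq2 : (3 * S / 8) ^ 2 ≤ C ^ 2 * (D * (D * hbar + D) * L) := by
      have h0 : 0 ≤ 3 * S / 8 := by positivity
      have h' := pow_le_pow_left₀ h0 hsq 2
      rw [mul_pow, Real.sq_sqrt hin] at h'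
      exact h'
    have f1 : 9 * (D * A) ^ 2 ≤ 64 * (C ^ 2 * cd ^ 2 * (D ^ 2 * ((hbar + 1) * L))) := by
      have e : (3 * S / 8) ^ 2 * (64 * cd ^ 2) = 9 * (S * cd) ^ 2 := by ring
      have h' := mul_le_mul_of_nonneg_right hsq2 (by positivity : (0:ℝ) ≤ 64 * cd ^ 2)
      rw [e, hScd] at h'
      linarith
    have f2 : 9 * A ^ 2 ≤ 64 * (C ^ 2 * cd ^ 2 * ((hbar + 1) * L)) := by
      have h' : (9 * A ^ 2) * D ^ 2 ≤ (64 * (C ^ 2 * cd ^ 2 * ((hbar + 1) * L))) * D ^ 2 := by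
        linarith [f1]
      exact le_of_mul_le_mul_right h' (by positivity)
    have f3 : 9 * (Δ * (hbar + 1) * A) ≤ 64 * (C ^ 2 * cd ^ 2 * ((hbar + 1) * L)) := by
      have h' := mul_le_mul_of_nonneg_right hAΔ hA0.le
      nlinarith [f2, h']
    have f4 : 9 * (Δ * A) ≤ 64 * (C ^ 2 * cd ^ 2 * L) := by
      have h' : (9 * (Δ * A)) * (hbar + 1) ≤ (64 * (C ^ 2 * cd ^ 2 * L)) * (hbar + 1) := by
        linarith [f3]
      exact le_of_mul_le_mul_right h' hh1
    rw [div_le_iff₀ (by positivity)]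
    linarith [f4, (by positivity : (0:ℝ) ≤ C ^ 2 * cd ^ 2 * L)]

/-- **Registered sub-goal `restart_threshold_arith`** (stub plan `CycleAPIAt3`, P4-ℝ; pure real
bookkeeping, numerically sampled by the critic): the floor `L ≥ Δ(Δh̄+Y)/(C₁c_d²)` beats the
restart threshold `C(Δ/c_f + 1)(Δ h_𝔮 + Y δ)` for a container of degree `δ` and height
`h_𝔮 ≤ p(h̄ + 1)` once `c_f ≥ 16 C C₁ c_d² (p+1) δ` and `Δ ≥ c_f`. [folklore] -/
theorem restart_threshold_arith : ∀ (C C₁ cd cf Δ Y hbar hq δ p L : ℝ), 1 ≤ C → 1 ≤ C₁ →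
    1 ≤ cd → 1 ≤ p → 1 ≤ δ → 16 * C * C₁ * cd ^ 2 * (p + 1) * δ ≤ cf → cf ≤ Δ → Δ ≤ Y →
    0 ≤ hbar → hq ≤ p * (hbar + 1) → Δ * (Δ * hbar + Y) / (C₁ * cd ^ 2) ≤ L →
    C * (Δ / cf + 1) * (Δ * hq + Y * δ) ≤ L := by
  intro C C₁ cd cf Δ Y hbar hq δ p L hC hC₁ hcd hp hδ hcf hΔ hY hh hhq hL
  have hcd2 : 1 ≤ cd ^ 2 := by nlinarith
  have hcf16 : 16 ≤ cf := by
    have : 16 * 1 * 1 * 1 * (1 + 1) * 1 ≤ 16 * C * C₁ * cd ^ 2 * (p + 1) * δ := by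
      gcongr
    linarith
  have hcf0 : 0 < cf := by linarith
  have hΔ0 : 0 < Δ := by linarith
  -- `Δ/cf + 1 ≤ 2Δ/cf`
  have hratio : Δ / cf + 1 ≤ 2 * (Δ / cf) := by
    have : 1 ≤ Δ / cf := by rw [le_div_iff₀ hcf0]; linarith
    linarith
  -- `Δ hq + Y δ ≤ Δ p (h̄+1) + Y δ`, nonneg
  have hin : Δ * hq + Y * δ ≤ Δ * (p * (hbar + 1)) + Y * δ := by nlinarith
  have hin0 : 0 ≤ Δ * (p * (hbar + 1)) + Y * δ := by
    have : 0 ≤ p * (hbar + 1) := by nlinarith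
    nlinarith
  -- reduce to `2 C Δ (Δ p (h̄+1) + Y δ) / cf ≤ Δ (Δ h̄ + Y)/(C₁ cd²)`
  have hstep1 : C * (Δ / cf + 1) * (Δ * hq + Y * δ) ≤
      2 * C * (Δ / cf) * (Δ * (p * (hbar + 1)) + Y * δ) := by
    have hC0 : 0 ≤ C := by linarith
    have ha : C * (Δ / cf + 1) * (Δ * hq + Y * δ) ≤ C * (Δ / cf + 1) * (Δ * (p * (hbar + 1)) + Y * δ) :=
      mul_le_mul_of_nonneg_left hin (mul_nonneg hC0 (by positivity))
    have hb : C * (Δ / cf + 1) * (Δ * (p * (hbar + 1)) + Y * δ) ≤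
        C * (2 * (Δ / cf)) * (Δ * (p * (hbar + 1)) + Y * δ) :=
      mul_le_mul_of_nonneg_right (mul_le_mul_of_nonneg_left hratio hC0) hin0
    linarith
  refine hstep1.trans (le_trans ?_ hL)
  -- `2 C Δ X / cf ≤ Δ (Δh̄+Y)/(C₁ cd²)` iff `2 C C₁ cd² X ≤ cf (Δ h̄ + Y)` (times Δ > 0)
  rw [show 2 * C * (Δ / cf) * (Δ * (p * (hbar + 1)) + Y * δ) =
      Δ * (2 * C * (Δ * (p * (hbar + 1)) + Y * δ)) / cf by ring]
  rw [div_le_div_iff₀ hcf0 (by positivity)]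
  -- `Δ (2C X) (C₁ cd²) ≤ Δ (Δh̄+Y) cf`
  have hX : 2 * C * (Δ * (p * (hbar + 1)) + Y * δ) * (C₁ * cd ^ 2) ≤ (Δ * hbar + Y) * cf := by
    -- use `cf ≥ 16 C C₁ cd² (p+1) δ`
    have hR : (Δ * hbar + Y) * (16 * C * C₁ * cd ^ 2 * (p + 1) * δ) ≤ (Δ * hbar + Y) * cf :=
      mul_le_mul_of_nonneg_left hcf (by nlinarith)
    refine le_trans ?_ hR
    -- `2 (Δ p (h̄+1) + Y δ) ≤ 16 (p+1) δ (Δ h̄ + Y)`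
    have hcore : 2 * (Δ * (p * (hbar + 1)) + Y * δ) ≤ 16 * ((p + 1) * δ) * (Δ * hbar + Y) := by
      -- `2Δ p h̄ ≤ 16 (p+1) δ Δ h̄`, `2 Δ p ≤ 16 (p+1) δ Y`, `2 Y δ ≤ 16 (p+1) δ Y`... wait last uses Y ≥ 0
      have hY0 : 0 ≤ Y := by linarith
      have t1 : Δ * (p * hbar) ≤ (p + 1) * δ * (Δ * hbar) := by
        have : p ≤ (p + 1) * δ := by nlinarith
        nlinarith [mul_nonneg hΔ0.le hh]
      have t2 : Δ * p ≤ (p + 1) * δ * Y := by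
        have : p ≤ (p + 1) * δ := by nlinarith
        nlinarith
      have t3 : Y * δ ≤ (p + 1) * δ * Y := by
        nlinarith [mul_nonneg (mul_nonneg (by linarith : (0:ℝ) ≤ p) (by linarith : (0:ℝ) ≤ δ)) hY0]
      nlinarith
    have hCC : 0 ≤ C * (C₁ * cd ^ 2) := by
      have : 0 ≤ C := by linarith
      have : 0 ≤ C₁ * cd ^ 2 := by nlinarith
      positivity
    nlinarith [mul_le_mul_of_nonneg_left hcore hCC]
  nlinarith [mul_le_mul_of_nonneg_left hX hΔ0.le]

end Summit.Schanuel.Schanuel.Cruxes.ApproximationProperty.OrbitInterpolationDeterminant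

end
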